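import Summits.Ventures.PercRepro.S1CFCapsTools

/-!
# PercRepro — THE TRIANGLES THROUGH A POINT OF A COLOOP-FREE MATROID OF NULLITY `4` NUMBER AT MOST `6` (p1, gen 37)

The relative partner cover and its consequence for p7's ν = 4 program, stated for ANY number `n ≥ 10` of points (the
contractions `N = M ／ W` at `w = 9, 8, 7, 6` have `12, 13, 14, 15` points).
* **`two_mul_eRk_sub_le_ncard_of_rel_partner`** — for an independent `S` and `Y` disjoint from `cl S`, if every `u ∈ Y` has a
  partner `v ∈ Y` with `S ∪ {u, v}` dependent, then `2 · (rk (S ∪ Y) − rk S) ≤ |Y|` (`Y` is a union of relative parallel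
  classes `Y ∩ cl (S ∪ {u})`, each of relative rank `1`; strong induction removing a whole class);
* **`ncard_le_eRk_toNat_add_three_of_lt`** — a subset of rank `< rk E` has nullity `≤ 3` (any `n`);
* **`ncard_triangles_through_le_six`** — in a loopless coloop-free matroid of nullity `4` on `n ≥ 10` points, the triangles
  through a point `x` number at most `6`: they are `{x} ∪ P` with `P` a relative circuit of size `2` inside the set `Y₀` of
  points lying on a triangle with `x`; `{x} ∪ Y₀ ≠ E` (else the relative cover gives `2 · (n − 5) ≤ n − 1`), so its nullity
  is `≤ 3` and the relative circuit count gives `C(4, 2)`;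
* **`ncard_triangles_le_sixteen`** — the triangles number at most `6 + 10 = 16` (`x` on a triangle, `E ∖ {x}` of nullity `3`).
Nothing about any cell is claimed. Axioms: standard.
-/

open scoped Matroid

namespace PercRepro

namespace S1CF

open Set

variable {α : Type}

/-- A subset of rank smaller than the rank of the ground set has nullity `≤ 3` (coloop-free, nullity `4`). -/
theorem ncard_le_eRk_toNat_add_three_of_lt (M : Matroid α) [M.Finite] (hK : ∀ e, ¬ M.IsColoop e)
    (hd : M.E.encard = M.eRank + ((4 : ℕ) : ℕ∞)) {X : Set α} (hX : X ⊆ M.E)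
    (hr : (M.eRk X).toNat < (M.eRk M.E).toNat) : X.ncard ≤ (M.eRk X).toNat + 3 := by
  have hne : X ≠ M.E := by
    intro h; rw [h] at hr; omega
  have := ncard_add_one_le_eRk_toNat_add_of_ssubset M hd hK hX hne
  omega

/-- **The relative partner cover**: for `S` independent and `Y ⊆ E ∖ cl S`, if every point of `Y` has a partner `v ∈ Y`
(`v ≠ u`, `S ∪ {u, v}` dependent) then `2 · rk (S ∪ Y) ≤ |Y| + 2 · rk S`. -/
theorem two_mul_eRk_le_ncard_add_of_rel_partner (M : Matroid α) [M.Finite] {S : Set α} (hS : S ⊆ M.E)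
    (hSi : M.Indep S) :
    ∀ (n : ℕ) (Y : Set α), Y ⊆ M.E → Disjoint Y (M.closure S) → Y.ncard = n →
      (∀ u ∈ Y, ∃ v ∈ Y, v ≠ u ∧ M.Dep (S ∪ {u, v})) →
      2 * (M.eRk (S ∪ Y)).toNat ≤ Y.ncard + 2 * (M.eRk S).toNat := by
  intro n
  induction n using Nat.strong_induction_on with
  | _ n ih =>
    intro Y hY hYcl hYn hpart
    have hEfin := M.ground_finite
    have hYfin : Y.Finite := hEfin.subset hY
    rcases Y.eq_empty_or_nonempty with hYe | ⟨u, huY⟩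
    · subst hYe; simp
    have huE : u ∈ M.E := hY huY
    have huS : u ∉ S := fun h => hYcl.notMem_of_mem_left huY (M.subset_closure S hS h)
    have hSu : M.Indep (insert u S) := by
      rw [hSi.insert_indep_iff_of_notMem huS]
      exact ⟨huE, hYcl.notMem_of_mem_left huY⟩
    -- the relative class of `u`
    set K : Set α := Y ∩ M.closure (insert u S) with hKdef
    set Y' : Set α := Y \ K with hY'def
    have hKY : K ⊆ Y := inter_subset_left
    have huK : u ∈ K := ⟨huY, M.subset_closure _ (Set.insert_subset huE hS) (Set.mem_insert u S)⟩
    obtain ⟨v, hvY, hvu, hdep⟩ := hpart u huY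
    have hvK : v ∈ K := by
      refine ⟨hvY, ?_⟩
      have : M.Dep (insert v (insert u S)) := by
        have e : insert v (insert u S) = S ∪ {u, v} := by
          ext w; simp only [Set.mem_insert_iff, Set.mem_union, Set.mem_singleton_iff]; tauto
        rw [e]; exact hdep
      rw [hSu.insert_dep_iff] at this
      exact this.1
    have hKfin : K.Finite := hYfin.subset hKY
    have hK2 : 2 ≤ K.ncard := by
      have : ({u, v} : Set α) ⊆ K := by
        intro w hw; rcases hw with rfl | rfl; exacts [huK, hvK]
      rw [← Set.ncard_pair (Ne.symm hvu)]
      exact Set.ncard_le_ncard this hKfin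
    -- partners of points outside `K` stay outside `K`
    have hpart' : ∀ u' ∈ Y', ∃ v' ∈ Y', v' ≠ u' ∧ M.Dep (S ∪ {u', v'}) := by
      intro u' hu'
      obtain ⟨v', hv'Y, hv'u', hdep'⟩ := hpart u' hu'.1
      refine ⟨v', ⟨hv'Y, ?_⟩, hv'u', hdep'⟩
      intro hv'K
      apply hu'.2
      refine ⟨hu'.1, ?_⟩
      have hv'E : v' ∈ M.E := hY hv'Y
      have hv'S : v' ∉ S := fun h => hYcl.notMem_of_mem_left hv'Y (M.subset_closure S hS h)
      have hSv' : M.Indep (insert v' S) := by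
        rw [hSi.insert_indep_iff_of_notMem hv'S]
        exact ⟨hv'E, hYcl.notMem_of_mem_left hv'Y⟩
      have h1 : u' ∈ M.closure (insert v' S) := by
        have : M.Dep (insert u' (insert v' S)) := by
          have e : insert u' (insert v' S) = S ∪ {u', v'} := by
            ext w; simp only [Set.mem_insert_iff, Set.mem_union, Set.mem_singleton_iff]; tauto
          rw [e]; exact hdep'
        rw [hSv'.insert_dep_iff] at this
        exact this.1
      have h2 : M.closure (insert v' S) ⊆ M.closure (insert u S) := by
        apply M.closure_subset_closure_of_subset_closure
        exact Set.insert_subset hv'K.2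
          ((Set.subset_insert u S).trans (M.subset_closure (insert u S) (Set.insert_subset huE hS)))
      exact h2 h1
    have hY'Y : Y' ⊆ Y := sdiff_subset
    have hcard : Y'.ncard + K.ncard = Y.ncard := Set.ncard_sdiff_add_ncard_of_subset hKY hYfin
    have hlt : Y'.ncard < n := by omega
    have ih' := ih _ hlt Y' (hY'Y.trans hY) (hYcl.mono_left hY'Y) rfl hpart'
    -- the rank step: `rk (S ∪ Y) ≤ rk (S ∪ Y') + 1` by submodularity on `S ∪ Y'` and `S ∪ K`
    have hSK : M.eRk (S ∪ K) ≤ M.eRk S + 1 := by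
      have h1 : M.eRk (S ∪ K) ≤ M.eRk (insert u S) := by
        have : S ∪ K ⊆ M.closure (insert u S) :=
          union_subset ((M.subset_closure S hS).trans (M.closure_subset_closure (Set.subset_insert u S)))
            inter_subset_right
        calc M.eRk (S ∪ K) ≤ M.eRk (M.closure (insert u S)) := M.eRk_mono this
          _ = M.eRk (insert u S) := M.eRk_closure_eq _
      exact h1.trans (M.eRk_insert_le_add_one u S)
    have hsub : M.eRk ((S ∪ Y') ∪ (S ∪ K)) + M.eRk ((S ∪ Y') ∩ (S ∪ K)) ≤ M.eRk (S ∪ Y') + M.eRk (S ∪ K) := by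
      have := M.eRk_inter_add_eRk_union_le (S ∪ Y') (S ∪ K)
      rw [add_comm] at this
      exact this
    have hU : (S ∪ Y') ∪ (S ∪ K) = S ∪ Y := by
      ext w
      simp only [Set.mem_union, hY'def, Set.mem_sdiff]
      constructor
      · rintro ((h | ⟨h, -⟩) | (h | h))
        · exact Or.inl h
        · exact Or.inr h
        · exact Or.inl h
        · exact Or.inr (hKY h)
      · rintro (h | h)
        · exact Or.inl (Or.inl h)
        · by_cases hK : w ∈ K
          · exact Or.inr (Or.inr hK)
          · exact Or.inl (Or.inr ⟨h, hK⟩)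
    have hI : S ⊆ (S ∪ Y') ∩ (S ∪ K) := subset_inter subset_union_left subset_union_left
    have hrkI : M.eRk S ≤ M.eRk ((S ∪ Y') ∩ (S ∪ K)) := M.eRk_mono hI
    rw [hU] at hsub
    have hmain : M.eRk (S ∪ Y) + M.eRk S ≤ M.eRk (S ∪ Y') + M.eRk S + 1 := by
      calc M.eRk (S ∪ Y) + M.eRk S ≤ M.eRk (S ∪ Y) + M.eRk ((S ∪ Y') ∩ (S ∪ K)) := by gcongr
        _ ≤ M.eRk (S ∪ Y') + M.eRk (S ∪ K) := hsub
        _ ≤ M.eRk (S ∪ Y') + (M.eRk S + 1) := by gcongr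
        _ = M.eRk (S ∪ Y') + M.eRk S + 1 := by ring
    have hSYE : S ∪ Y ⊆ M.E := union_subset hS hY
    have hSY'E : S ∪ Y' ⊆ M.E := union_subset hS (hY'Y.trans hY)
    rw [← S1.coe_toNat_eRk M hSYE, ← S1.coe_toNat_eRk M hSY'E, ← S1.coe_toNat_eRk M hS] at hmain
    have hmainN : (M.eRk (S ∪ Y)).toNat + (M.eRk S).toNat ≤ (M.eRk (S ∪ Y')).toNat + (M.eRk S).toNat + 1 := by
      exact_mod_cast hmain
    omega

/-- The rank of `E ∖ {x}` is the rank of `E` (`x` not a coloop). -/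
theorem eRk_sdiff_singleton_eq_of_not_isColoop (M : Matroid α) {x : α} (hx : x ∈ M.E)
    (hK : ¬ M.IsColoop x) : M.eRk (M.E \ {x}) = M.eRk M.E := by
  have hxcl : x ∈ M.closure (M.E \ {x}) := by
    rw [Matroid.isColoop_iff_notMem_closure_compl hx] at hK
    push Not at hK
    exact hK
  apply le_antisymm (M.eRk_mono sdiff_subset)
  have h1 : M.E ⊆ M.closure (M.E \ {x}) := by
    intro y hy
    by_cases hyx : y = x
    · subst hyx; exact hxcl
    · exact M.subset_closure (M.E \ {x}) sdiff_subset ⟨hy, hyx⟩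
  calc M.eRk M.E ≤ M.eRk (M.closure (M.E \ {x})) := M.eRk_mono h1
    _ = M.eRk (M.E \ {x}) := M.eRk_closure_eq _

/-- `E ∖ {x}` has nullity `3` (natural-number form). -/
theorem ncard_sdiff_singleton_le_eRk_toNat_add_three (M : Matroid α) [M.Finite]
    (hK : ∀ e, ¬ M.IsColoop e) (hd : M.E.encard = M.eRank + ((4 : ℕ) : ℕ∞)) {x : α} (hx : x ∈ M.E) :
    (M.E \ {x}).ncard ≤ (M.eRk (M.E \ {x})).toNat + 3 := by
  have hEfin := M.ground_finite
  have h := ncard_ground_eq_eRk_toNat_add M hd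
  rw [eRk_sdiff_singleton_eq_of_not_isColoop M hx (hK x)]
  have := Set.ncard_sdiff_singleton_add_one hx hEfin
  omega

/-- **The triangles through a point number at most `6`** (loopless, coloop-free, nullity `4`, `n ≥ 10` points). -/
theorem ncard_triangles_through_le_six (M : Matroid α) [M.Finite] (hL : ∀ e ∈ M.E, ¬ M.IsLoop e)
    (hK : ∀ e, ¬ M.IsColoop e) (hd : M.E.encard = M.eRank + ((4 : ℕ) : ℕ∞)) (hn : 10 ≤ M.E.ncard) {x : α}
    (hx : x ∈ M.E) : {C : Set α | C ⊆ M.E ∧ M.IsCircuit C ∧ C.ncard = 3 ∧ x ∈ C}.ncard ≤ 6 := by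
  classical
  have hEfin := M.ground_finite
  have hxI : M.Indep {x} := indep_singleton_of_not_isLoop M hx (hL x hx)
  -- the points on a triangle with `x`
  set Y₀ : Set α := {u ∈ M.E | u ∉ M.closure {x} ∧ ∃ v ∈ M.E, v ∉ M.closure {x} ∧ v ≠ u ∧ M.IsCircuit {x, u, v}}
    with hY₀def
  have hY₀E : Y₀ ⊆ M.E := fun u hu => hu.1
  have hY₀cl : Disjoint Y₀ (M.closure {x}) := by
    rw [Set.disjoint_left]
    intro u hu hucl
    exact hu.2.1 hucl
  have hpart : ∀ u ∈ Y₀, ∃ v ∈ Y₀, v ≠ u ∧ M.Dep ({x} ∪ {u, v}) := by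
    intro u hu
    obtain ⟨huE, hucl, v, hvE, hvcl, hvu, hC⟩ := hu
    refine ⟨v, ⟨hvE, hvcl, u, huE, hucl, Ne.symm hvu, by rw [Set.pair_comm v u]; exact hC⟩, hvu, ?_⟩
    have e : ({x} ∪ {u, v} : Set α) = {x, u, v} := by
      ext w; simp only [Set.mem_union, Set.mem_singleton_iff, Set.mem_insert_iff]
    rw [e]; exact hC.dep
  -- `{x} ∪ Y₀ ≠ E` by the relative cover
  have hne : {x} ∪ Y₀ ≠ M.E := by
    intro hU
    have hcov := two_mul_eRk_le_ncard_add_of_rel_partner M (Set.singleton_subset_iff.2 hx) hxI Y₀.ncard Y₀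
      hY₀E hY₀cl rfl hpart
    rw [hU] at hcov
    have hxY : x ∉ Y₀ := fun h => h.2.1 (M.mem_closure_self x hx)
    have hcard : Y₀.ncard + 1 = M.E.ncard := by
      have : ({x} ∪ Y₀).ncard = Y₀.ncard + 1 := by
        rw [Set.singleton_union, Set.ncard_insert_of_notMem hxY (hEfin.subset hY₀E)]
      rw [← this, hU]
    have hrx : (M.eRk {x}).toNat = 1 := by
      rw [hxI.eRk_eq_encard, Set.encard_singleton]; rfl
    rw [hrx] at hcov
    have h8 := ncard_ground_eq_eRk_toNat_add M hd
    omega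
  have hUE : {x} ∪ Y₀ ⊆ M.E := union_subset (Set.singleton_subset_iff.2 hx) hY₀E
  have hν := ncard_add_one_le_eRk_toNat_add_of_ssubset M hd hK hUE hne
  have hrel := ncard_relCircuits_le M 2 (by norm_num) 3 {x} Y₀ (Set.singleton_subset_iff.2 hx) hY₀E
    (Set.disjoint_singleton_left.2 (fun h => h.2.1 (M.mem_closure_self x hx))) hxI (by omega)
  norm_num at hrel
  -- the injection `C ↦ C ∖ {x}`
  have hmap : ∀ C ∈ {C : Set α | C ⊆ M.E ∧ M.IsCircuit C ∧ C.ncard = 3 ∧ x ∈ C},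
      (fun C : Set α => C \ {x}) C ∈
        {P : Set α | P ⊆ Y₀ ∧ P.ncard = 2 ∧ M.Dep ({x} ∪ P) ∧ ∀ Q, Q ⊂ P → M.Indep ({x} ∪ Q)} := by
    intro C hC
    obtain ⟨hCE, hCc, hC3, hxC⟩ := hC
    have hCfin : C.Finite := hEfin.subset hCE
    have hP2 : (C \ {x}).ncard = 2 := by rw [Set.ncard_sdiff_singleton_of_mem hxC, hC3]
    have hPeq : {x} ∪ (C \ {x}) = C := by
      rw [Set.singleton_union, Set.insert_sdiff_singleton, Set.insert_eq_of_mem hxC]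
    refine ⟨?_, hP2, by rw [hPeq]; exact hCc.dep, ?_⟩
    · intro u hu
      have hu : u ∈ C \ {x} := hu
      obtain ⟨a, b, hab, hCx⟩ := Set.ncard_eq_two.1 hP2
      have hnocl : ∀ w ∈ C \ {x}, w ∉ M.closure {x} := by
        intro w hw hwcl
        have hdep : M.Dep {x, w} := by
          have : M.Dep (insert w {x}) := by
            rw [hxI.insert_dep_iff]; exact ⟨hwcl, hw.2⟩
          rwa [Set.pair_comm]
        exact not_dep_pair_of_isCircuit M hCc (by
          intro z hz; rcases hz with rfl | rfl; exacts [hxC, hw.1]) (Set.ncard_pair (Ne.symm hw.2)) (by omega) hdep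
      have hmemC : ∀ w ∈ C \ {x}, w ∈ M.E := fun w hw => hCE hw.1
      refine ⟨hmemC u hu, hnocl u hu, ?_⟩
      -- the other point of `C ∖ {x}`
      have hu' : u = a ∨ u = b := by rw [hCx] at hu; simpa using hu
      have ha : a ∈ C \ {x} := by rw [hCx]; simp
      have hb : b ∈ C \ {x} := by rw [hCx]; simp
      have hCeq : ∀ v w : α, v ≠ w → ({v, w} : Set α) = C \ {x} → C = {x, v, w} := by
        intro v w _ hvw
        rw [← hPeq, ← hvw, Set.singleton_union]
      rcases hu' with rfl | rfl
      · exact ⟨b, hmemC b hb, hnocl b hb, hab.symm, hCeq u b hab hCx.symm ▸ hCc⟩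
      · exact ⟨a, hmemC a ha, hnocl a ha, hab, (hCeq u a hab.symm (by rw [Set.pair_comm]; exact hCx.symm)) ▸ hCc⟩
    · intro Q hQ
      have h : {x} ∪ Q ⊂ C := by
        rw [← hPeq]
        refine ⟨Set.union_subset_union_right {x} hQ.subset, ?_⟩
        intro hcon
        apply hQ.not_subset
        intro w hw
        have : w ∈ {x} ∪ Q := hcon (Or.inr hw)
        rcases this with h1 | h1
        · exact absurd (Set.mem_singleton_iff.1 h1) hw.2
        · exact h1
      exact hCc.ssubset_indep h
  have hinj : Set.InjOn (fun C : Set α => C \ {x}) {C : Set α | C ⊆ M.E ∧ M.IsCircuit C ∧ C.ncard = 3 ∧ x ∈ C} := by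
    intro C hC C' hC' h
    simp only at h
    have e1 : C = insert x (C \ {x}) := by rw [Set.insert_sdiff_singleton, Set.insert_eq_of_mem hC.2.2.2]
    have e2 : C' = insert x (C' \ {x}) := by rw [Set.insert_sdiff_singleton, Set.insert_eq_of_mem hC'.2.2.2]
    rw [e1, e2, h]
  exact (Set.ncard_le_ncard_of_injOn _ hmap hinj (relCircuits_finite M {x} hY₀E 2)).trans hrel

/-- **The triangles number at most `16`**: `≤ 6` through a point of one of them and `≤ 10` inside `E ∖ {x}` (nullity `3`). -/
theorem ncard_triangles_le_sixteen (M : Matroid α) [M.Finite] (hL : ∀ e ∈ M.E, ¬ M.IsLoop e)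
    (hK : ∀ e, ¬ M.IsColoop e) (hd : M.E.encard = M.eRank + ((4 : ℕ) : ℕ∞)) (hn : 10 ≤ M.E.ncard) :
    {C : Set α | C ⊆ M.E ∧ M.IsCircuit C ∧ C.ncard = 3}.ncard ≤ 16 := by
  classical
  have hEfin := M.ground_finite
  set 𝒯 := {C : Set α | C ⊆ M.E ∧ M.IsCircuit C ∧ C.ncard = 3} with h𝒯
  rcases 𝒯.eq_empty_or_nonempty with hemp | ⟨T₀, hT₀⟩
  · rw [hemp]; simp
  obtain ⟨hT₀E, hT₀c, hT₀3⟩ := hT₀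
  obtain ⟨x, hxT₀⟩ : T₀.Nonempty := by rw [← Set.ncard_pos (hEfin.subset hT₀E), hT₀3]; norm_num
  have hx : x ∈ M.E := hT₀E hxT₀
  have hsplit : 𝒯 ⊆ {C : Set α | C ⊆ M.E ∧ M.IsCircuit C ∧ C.ncard = 3 ∧ x ∈ C} ∪
      {C : Set α | C ⊆ M.E \ {x} ∧ M.IsCircuit C ∧ C.ncard = 3} := by
    intro C hC
    by_cases hxC : x ∈ C
    · exact Or.inl ⟨hC.1, hC.2.1, hC.2.2, hxC⟩
    · exact Or.inr ⟨Set.subset_sdiff_singleton hC.1 hxC, hC.2.1, hC.2.2⟩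
  have h6 := ncard_triangles_through_le_six M hL hK hd hn hx
  have h10 : {C : Set α | C ⊆ M.E \ {x} ∧ M.IsCircuit C ∧ C.ncard = 3}.ncard ≤ 10 := by
    have := ncard_isCircuit_ncard_eq_le M (ν := 3) (k := 3) (by norm_num) (sdiff_subset : M.E \ {x} ⊆ M.E)
      (ncard_sdiff_singleton_le_eRk_toNat_add_three M hK hd hx)
    norm_num at this
    exact this
  calc 𝒯.ncard ≤ ({C : Set α | C ⊆ M.E ∧ M.IsCircuit C ∧ C.ncard = 3 ∧ x ∈ C} ∪
        {C : Set α | C ⊆ M.E \ {x} ∧ M.IsCircuit C ∧ C.ncard = 3}).ncard :=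
        Set.ncard_le_ncard hsplit ((hEfin.finite_subsets.subset (fun C hC => hC.1)).union
          (hEfin.finite_subsets.subset (fun C hC => hC.1.trans sdiff_subset)))
    _ ≤ _ := Set.ncard_union_le _ _
    _ ≤ 6 + 10 := add_le_add h6 h10
    _ = 16 := by norm_num


end S1CF

end PercRepro
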